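import Literature.MathematicalPhysics.QuantumManyBody.BoseGasNoHardCore
import Literature.MathematicalPhysics.QuantumManyBody.BoseGasHardSetContact

/-!
# Blow-up of the energy per particle at the critical density, for every pair potential:
# proof of `LSSY2005_e0_dirichlet_exists`

Topic `Literature/MathematicalPhysics/QuantumManyBody`, over `BoseGasThermodynamicLimit.lean`
(the vendored facts `LSSY2005_e0_dirichlet_exists`, `LSSY2005_e0_periodic_eq_dirichlet`),
`BoseGasThermodynamicLimitRuelle.lean` (Ruelle's thermodynamic limit off the critical density,
`criticalDensity`, `LSSY2005_e0_dirichlet_exists_iff_atCritical`),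
`BoseGasBoundaryConditionIndependence.lean` (the blow-up case
`tendsto_energyPerParticleDirichlet_top_of_iSup_limsup_eq_top`,
`LSSY2005_e0_periodic_eq_dirichlet_iff_atCritical_of_iSup_lt_top`),
`BoseGasHardCoreCriticalDensity.lean` (the free-volume argument for hard cores with bounded tail:
box fit `exists_forall_box_fit`, `cubeAt`, `card_filter_dist_lt_le_pow`), and the three files
generalising its inputs to an ARBITRARY measurable finite-range potential: `BoseGasHardSet.lean`
(hard set `𝓗(v)`, hard radii, loose shells), `BoseGasNoHardCore.lean` (no hard core ⇒ `ρ_c = ∞`),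
`BoseGasHardSetContact.lean` (few tight pairs at finite energy), `BoseGasClusterStates.lean`
(interacting cluster trial states).

Main results:

* `limsupEnergyPerParticle_lt_top_of_compression_hardSet` — **the compression lemma for a general
  potential with a hard core**: if `B(0,a) ⊆ 𝓗(v)` and `E₀^D(N, L_N(ρ')) ≤ G N` eventually, then
  `e⁺(ρ'(1 + δ/(8(R₀+a)))) < ∞` for small `δ`;
* `iSup_limsupEnergyPerParticle_eq_top_of_criticalDensity_le` — **blow-up at the critical
  density for EVERY repulsive finite-range potential**: if `ρ_c(v) ≤ ρ` then
  `sup_{0<ρ'<ρ} e⁺(ρ') = +∞` (a finite `ρ_c` forces a hard core by `BoseGasNoHardCore`, and then the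
  compression lemma contradicts the definition of `ρ_c`);
* `LSSY2005_e0_dirichlet_exists_holds` — hence the Dirichlet energies per particle converge at
  every density for every potential of the standing class: **the vendored fact
  `LSSY2005_e0_dirichlet_exists` holds as stated** (below `ρ_c` by Ruelle, at and above `ρ_c` to
  `+∞`); likewise `LSSY2005_e0_periodic_eq_dirichlet_holds`.

Proof of the compression lemma (free volume, as in the hard-sphere file, with the hard set in
place of the core): a near-minimiser `ψ` at density `ρ'` has `∫|∇ψ|² ≤ (G+1)N`, so by
`sum_lintegral_tightPair_le` and Markov it does not vanish at a configuration `X₀` with at most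
`εN + 1` tight particles, `ε = 200 (2(R₀+a)/a+1)³ (G+1) δ²`; at `X₀` all pairs are `> a` apart and
off the hard spheres, and the non-tight particles have all their pair distances `≥ δ` away from
every hard radius. Keep `M ≥ (1-ε)N - 1` of them, scale by `μ = 1 - δ/(4(R₀+a))` (pair distances
`≤ R₀ + a` move by `≤ δ/4`, larger ones stay `≥ a - δ/4` above every hard radius) and put each in
a cube of side `δ/16`: every ball of radius `δ/8` around a relative position of two cubes lies in
the loose shell `{dist(|w|, hard radii) ≥ δ/2, |w| ≤ R₀ + a}` (or beyond the range), on which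
`∫ v(|w|) dw < ∞` (`setLIntegral_looseShell_lt_top`), and each cube has at most `(4(R₀+a)/a+1)³`
partners within range; so by `exists_infEnergy_clusterRegion_le` the `M` bosons have energy
`≤ M e₁` in a box of side `μ L_N + 2δ`, which fits into the box of `M` particles at density
`ρ'(1 + δ/(8(R₀+a)))` since `(1 + δ/(8(R₀+a))) μ³ < 1 - ε` once `ε ≤ δ/(8(R₀+a))`.

References: E. H. Lieb, R. Seiringer, J. P. Solovej, J. Yngvason, *The Mathematics of the Bose Gas
and its Condensation* (2005) [LSSY2005], Ch. 2, eq. (2.2) and the paragraph following it ("These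
[boundary conditions] should not matter"); D. Ruelle, *Statistical Mechanics: Rigorous Results*
(1969) [Ruelle1969], §3.3.12, §3.5.11. The free-volume argument for these carriers is not in
print to our knowledge and is tagged folklore.
-/

noncomputable section

open MeasureTheory Filter Topology Set Function Metric
open scoped ENNReal NNReal

namespace Literature.MathematicalPhysics.QuantumManyBody.BoseGas

/-! ### The Markov step for the tight count -/

section Markov

variable {N : ℕ} {a δ R₀ : ℝ} {v : ℝ → ℝ≥0∞}

/-- The number of ordered tight pairs `(i, j)` of the configuration `X`. [folklore] -/
def tightCount (v : ℝ → ℝ≥0∞) (a δ : ℝ) (X : Config N) : ℝ≥0∞ :=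
  ∑ i : Fin N, ∑ j ∈ Finset.univ.erase i, (tightPair v a δ i j).indicator (fun _ => (1 : ℝ≥0∞)) X

open Classical in
/-- The **tight particles**: those with a tight partner. [folklore] -/
def tightParticles (v : ℝ → ℝ≥0∞) (a δ : ℝ) (X : Config N) : Finset (Fin N) :=
  Finset.univ.filter fun i => ∃ j ∈ Finset.univ.erase i, X ∈ tightPair v a δ i j

/-- Each tight particle accounts for at least one ordered tight pair. [folklore] -/
theorem card_tightParticles_le (X : Config N) :
    ((tightParticles v a δ X).card : ℝ≥0∞) ≤ tightCount v a δ X := by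
  classical
  rw [tightCount, Finset.card_eq_sum_ones, Nat.cast_sum]
  simp only [Nat.cast_one]
  calc ∑ _i ∈ tightParticles v a δ X, (1 : ℝ≥0∞)
      ≤ ∑ i ∈ tightParticles v a δ X, ∑ j ∈ Finset.univ.erase i,
          (tightPair v a δ i j).indicator (fun _ => (1 : ℝ≥0∞)) X := by
        refine Finset.sum_le_sum fun i hi => ?_
        simp only [tightParticles, Finset.mem_filter, Finset.mem_univ, true_and] at hi
        obtain ⟨j, hj, hX⟩ := hi
        calc (1 : ℝ≥0∞) = (tightPair v a δ i j).indicator (fun _ => (1 : ℝ≥0∞)) X :=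
              (indicator_of_mem hX (fun _ => (1 : ℝ≥0∞))).symm
          _ ≤ ∑ j ∈ Finset.univ.erase i, (tightPair v a δ i j).indicator (fun _ => (1 : ℝ≥0∞)) X :=
              Finset.single_le_sum (f := fun j => (tightPair v a δ i j).indicator
                (fun _ => (1 : ℝ≥0∞)) X) (fun _ _ => zero_le) hj
    _ ≤ tightCount v a δ X :=
        Finset.sum_le_sum_of_subset_of_nonneg (Finset.subset_univ _) fun _ _ _ => zero_le

/-- A particle that is not tight keeps all its pair distances beyond the core at distance `≥ δ`
from every hard radius. [folklore] -/
theorem le_abs_sub_of_not_mem_tightParticles {X : Config N} {i : Fin N}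
    (hi : i ∉ tightParticles v a δ X) {j : Fin N} (hji : j ≠ i) (hgt : a < dist (X i) (X j))
    {h : ℝ} (hh : h ∈ hardRad v) : δ ≤ |dist (X i) (X j) - h| := by
  by_contra hlt
  apply hi
  simp only [tightParticles, Finset.mem_filter, Finset.mem_univ, true_and]
  exact ⟨j, Finset.mem_erase.2 ⟨hji, Finset.mem_univ _⟩, hgt, h, hh, not_le.1 hlt⟩

/-- The expected tight count is controlled by the kinetic energy. [folklore] -/
theorem lintegral_tightCount_mul_le (ha : 0 < a) (hδ : 0 < δ) (hδa : 20 * δ ≤ a) (hR : 0 ≤ R₀)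
    (hv : Measurable v) (hrange : ∀ r, R₀ < r → v r = 0)
    (hcore : ball (0 : Space) a ⊆ hardVec v) {ψ : Config N → ℂ} (hψ : ContDiff ℝ 1 ψ)
    (hE : rawEnergy v ψ ≠ ⊤) :
    ∫⁻ X, tightCount v a δ X * (‖ψ X‖₊ : ℝ≥0∞) ^ 2 ≤
      ENNReal.ofReal (200 * (2 * (R₀ + a) / a + 1) ^ 3 * δ ^ 2) * ∫⁻ X, kineticDensity ψ X := by
  have hf : Measurable fun X => (‖ψ X‖₊ : ℝ≥0∞) ^ 2 := measurable_ennnormSq hψ.continuous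
  have hm : ∀ i j, Measurable fun X => (tightPair v a δ i j).indicator
      (fun X => (‖ψ X‖₊ : ℝ≥0∞) ^ 2) X :=
    fun i j => hf.indicator (isOpen_tightPair i j).measurableSet
  have hpt : ∀ X, tightCount v a δ X * (‖ψ X‖₊ : ℝ≥0∞) ^ 2 = ∑ i : Fin N,
      ∑ j ∈ Finset.univ.erase i, (tightPair v a δ i j).indicator
        (fun X => (‖ψ X‖₊ : ℝ≥0∞) ^ 2) X := by
    intro X
    rw [tightCount, Finset.sum_mul]
    refine Finset.sum_congr rfl fun i _ => ?_
    rw [Finset.sum_mul]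
    refine Finset.sum_congr rfl fun j _ => ?_
    by_cases hX : X ∈ tightPair v a δ i j <;> simp [hX]
  calc ∫⁻ X, tightCount v a δ X * (‖ψ X‖₊ : ℝ≥0∞) ^ 2
      = ∫⁻ X, ∑ i : Fin N, ∑ j ∈ Finset.univ.erase i,
          (tightPair v a δ i j).indicator (fun X => (‖ψ X‖₊ : ℝ≥0∞) ^ 2) X := lintegral_congr hpt
    _ = ∑ i : Fin N, ∑ j ∈ Finset.univ.erase i,
          ∫⁻ X, (tightPair v a δ i j).indicator (fun X => (‖ψ X‖₊ : ℝ≥0∞) ^ 2) X := by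
        rw [lintegral_finsetSum _ fun i _ =>
          show Measurable (fun X => ∑ j ∈ Finset.univ.erase i,
            (tightPair v a δ i j).indicator (fun X => (‖ψ X‖₊ : ℝ≥0∞) ^ 2) X) from
            Finset.measurable_sum _ fun j _ => hm i j]
        exact Finset.sum_congr rfl fun i _ => lintegral_finsetSum _ fun j _ => hm i j
    _ ≤ _ := sum_lintegral_tightPair_le ha hδ hδa hR hv hrange hcore hψ hE

/-- **The Markov step.** A normalised finite-energy `C¹` wave function does not vanish at some
configuration with tight count at most `200 (2(R₀+a)/a+1)³ δ² ∫|∇ψ|² + 1`. [folklore] -/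
theorem exists_ne_zero_tightCount_le (ha : 0 < a) (hδ : 0 < δ) (hδa : 20 * δ ≤ a) (hR : 0 ≤ R₀)
    (hv : Measurable v) (hrange : ∀ r, R₀ < r → v r = 0)
    (hcore : ball (0 : Space) a ⊆ hardVec v) {ψ : Config N → ℂ} (hψ : ContDiff ℝ 1 ψ)
    (hE : rawEnergy v ψ ≠ ⊤) (hnorm : ∫⁻ X, (‖ψ X‖₊ : ℝ≥0∞) ^ 2 = 1) :
    ∃ X : Config N, ψ X ≠ 0 ∧ tightCount v a δ X ≤
      ENNReal.ofReal (200 * (2 * (R₀ + a) / a + 1) ^ 3 * δ ^ 2) * (∫⁻ X, kineticDensity ψ X) + 1 := by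
  set B : ℝ≥0∞ := ENNReal.ofReal (200 * (2 * (R₀ + a) / a + 1) ^ 3 * δ ^ 2) *
    ∫⁻ X, kineticDensity ψ X with hB
  have hKE : ∫⁻ X, kineticDensity ψ X ≤ rawEnergy v ψ := lintegral_mono fun X => le_self_add
  have hBtop : B ≠ ⊤ := ENNReal.mul_ne_top ENNReal.ofReal_ne_top (ne_top_of_le_ne_top hE hKE)
  by_contra h
  simp only [not_exists, not_and, not_le] at h
  have hpt : ∀ X, (B + 1) * (‖ψ X‖₊ : ℝ≥0∞) ^ 2 ≤ tightCount v a δ X * (‖ψ X‖₊ : ℝ≥0∞) ^ 2 := by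
    intro X
    by_cases hX : ψ X = 0
    · simp [hX]
    · exact mul_le_mul' (h X hX).le le_rfl
  have hle : B + 1 ≤ B :=
    calc B + 1 = (B + 1) * ∫⁻ X, (‖ψ X‖₊ : ℝ≥0∞) ^ 2 := by rw [hnorm, mul_one]
      _ = ∫⁻ X, (B + 1) * (‖ψ X‖₊ : ℝ≥0∞) ^ 2 :=
          (lintegral_const_mul _ (measurable_ennnormSq hψ.continuous)).symm
      _ ≤ ∫⁻ X, tightCount v a δ X * (‖ψ X‖₊ : ℝ≥0∞) ^ 2 := lintegral_mono hpt
      _ ≤ B := lintegral_tightCount_mul_le ha hδ hδa hR hv hrange hcore hψ hE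
  exact absurd hle (not_le.2 (ENNReal.lt_add_right hBtop one_ne_zero))

end Markov

/-! ### The compression lemma for a general potential with a hard core -/

section Compression

variable {a R₀ : ℝ} {v : ℝ → ℝ≥0∞}

/-- With a hard core `B(0,a) ⊆ 𝓗(v)`, a finite-energy continuous wave function vanishes unless all
particles are pairwise `> a` apart. [cite: LSSY2005, Ch. 2, paragraph after eq. (2.1)] -/
theorem lt_dist_of_apply_ne_zero (ha : 0 < a) (hv : Measurable v)
    (hcore : ball (0 : Space) a ⊆ hardVec v) {N : ℕ} {ψ : Config N → ℂ} (hψ : Continuous ψ)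
    (hE : rawEnergy v ψ ≠ ⊤) {X : Config N} (hX : ψ X ≠ 0) {i j : Fin N} (hij : i ≠ j) :
    a < dist (X i) (X j) := by
  by_contra hle
  refine hX (eq_zero_of_sub_mem_hardVec hv hψ hE hij ?_)
  -- `closedBall 0 a ⊆ 𝓗(v)` since the hard set is closed
  have hcl : closedBall (0 : Space) a ⊆ hardVec v := by
    rw [← closure_ball (0 : Space) ha.ne']
    exact closure_minimal hcore isClosed_hardVec
  apply hcl
  rw [mem_closedBall, dist_zero_right, ← dist_eq_norm]
  exact not_lt.1 hle

set_option maxHeartbeats 1600000 in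
/-- **The compression lemma (free-volume argument, general potential).** Let `v` be measurable of
range `R₀ ≥ 0` with a hard core `B(0,a) ⊆ 𝓗(v)`. If along the cube sequence of density `ρ'` the
Dirichlet energies satisfy `E₀^D(N, L_N(ρ')) ≤ G N` for all large `N` (`G < ∞`), then for
`0 < δ ≤ a/20` with `12800 (2(R₀+a)/a+1)³ (R₀+a) (G+1) δ ≤ 1` the upper energy per particle is
finite at the strictly larger density `ρ'(1 + δ/(8(R₀+a)))`. [folklore] -/
theorem limsupEnergyPerParticle_lt_top_of_compression_hardSet (ha : 0 < a) (hR : 0 ≤ R₀)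
    (hv : Measurable v) (hrange : ∀ r, R₀ < r → v r = 0)
    (hcore : ball (0 : Space) a ⊆ hardVec v)
    {δ : ℝ} (hδ : 0 < δ) (hδa : 20 * δ ≤ a) {ρ' : ℝ} (hρ' : 0 < ρ') {G : ℝ≥0∞} (hG : G ≠ ⊤)
    (hδG : 12800 * (2 * (R₀ + a) / a + 1) ^ 3 * (R₀ + a) * (G.toReal + 1) * δ ≤ 1)
    (hbound : ∀ᶠ N : ℕ in atTop, groundStateEnergy v N (sideLength ρ' N) ≤ G * N) :
    limsupEnergyPerParticle v (ρ' * (1 + δ / (8 * (R₀ + a)))) < ⊤ := by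
  obtain ⟨N₀, hN₀⟩ := eventually_atTop.1 hbound
  -- constants
  have hRa : 0 < R₀ + a := by linarith
  set P : ℝ := (2 * (R₀ + a) / a + 1) ^ 3 with hP
  have hP1 : 1 ≤ P := by
    rw [hP]; exact one_le_pow₀ (by rw [le_add_iff_nonneg_left]; positivity)
  set g : ℝ := G.toReal with hg
  have hg0 : 0 ≤ g := ENNReal.toReal_nonneg
  have hG' : G = ENNReal.ofReal g := (ENNReal.ofReal_toReal hG).symm
  set x : ℝ := δ / (4 * (R₀ + a)) with hx
  have hx0 : 0 < x := by positivity
  have hx1 : x ≤ 1 / 80 := by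
    rw [hx, div_le_div_iff₀ (by positivity) (by norm_num)]
    nlinarith
  set ε : ℝ := 200 * P * δ ^ 2 * (g + 1) with hε
  have hε0 : 0 ≤ ε := by positivity
  have hεx : ε ≤ x / 2 := by
    -- `ε ≤ x/2 ⟺ 1600 P (R₀+a)(g+1) δ ≤ 1`, implied by `hδG`
    rw [hε, hx, div_div, show 4 * (R₀ + a) * 2 = 8 * (R₀ + a) by ring,
      le_div_iff₀ (by positivity)]
    have h1 : 200 * P * δ ^ 2 * (g + 1) * (8 * (R₀ + a)) =
        δ * (1600 * P * (R₀ + a) * (g + 1) * δ) := by ring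
    rw [h1]
    have h3 : 0 ≤ P * (R₀ + a) * (g + 1) * δ := by positivity
    have h2 : 1600 * P * (R₀ + a) * (g + 1) * δ ≤ 1 := by linarith
    calc δ * (1600 * P * (R₀ + a) * (g + 1) * δ) ≤ δ * 1 :=
          mul_le_mul_of_nonneg_left h2 hδ.le
      _ = δ := mul_one δ
  have hε1 : ε < 1 := by linarith
  set μ : ℝ := 1 - x with hμ
  have hμ0 : 0 < μ := by rw [hμ]; linarith
  have hμ1 : μ ≤ 1 := by rw [hμ]; linarith
  set s : ℝ := δ / 16 with hs
  have hs0 : 0 < s := by positivity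
  -- the loose-shell integral and the cluster constants
  set I : ℝ≥0∞ := ∫⁻ w in looseShell v (R₀ + 2 * a) (δ / 2), v ‖w‖ with hI
  have hItop : I < ⊤ := setLIntegral_looseShell_lt_top _ (by positivity)
  obtain ⟨E₁, C, hE₁, hC, hcluster⟩ := exists_infEnergy_clusterRegion_le hv hs0
  set P₂ : ℝ := (2 * (R₀ + a) / (a / 2) + 1) ^ 3 with hP₂
  set e₁ : ℝ≥0∞ := E₁ + C * (ENNReal.ofReal P₂ * I) with he₁
  have he₁top : e₁ < ⊤ := ENNReal.add_lt_top.2 ⟨hE₁, ENNReal.mul_lt_top hC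
    (ENNReal.mul_lt_top ENNReal.ofReal_lt_top hItop)⟩
  set ρ'' : ℝ := ρ' * (1 + δ / (8 * (R₀ + a))) with hρ''
  have hρ''x : ρ'' = ρ' * (1 + x / 2) := by
    rw [hρ'', hx, div_div, show 4 * (R₀ + a) * 2 = 8 * (R₀ + a) by ring]
  have hρ''0 : 0 < ρ'' := by positivity
  -- the strict density inequality `ρ'' μ³ < (1 - ε) ρ'`
  have hκ : ρ'' * μ ^ 3 < (1 - ε) * ρ' := by
    rw [hρ''x, hμ]
    have h1 : (1 + x / 2) * (1 - x) ^ 3 < 1 - x / 2 := by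
      have hexp : (1 + x / 2) * (1 - x) ^ 3 - (1 - x / 2) =
          -(x * (2 - 3 / 2 * x - 1 / 2 * x ^ 2 + 1 / 2 * x ^ 3)) := by ring
      have hpos : 0 < 2 - 3 / 2 * x - 1 / 2 * x ^ 2 + 1 / 2 * x ^ 3 := by
        have hx2 : x ^ 2 ≤ x := by nlinarith
        have hx3 : 0 ≤ x ^ 3 := by positivity
        linarith
      have := mul_pos hx0 hpos
      linarith
    have h2 : 1 - x / 2 ≤ 1 - ε := by linarith
    calc ρ' * (1 + x / 2) * (1 - x) ^ 3 = ρ' * ((1 + x / 2) * (1 - x) ^ 3) := by ring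
      _ < ρ' * (1 - ε) := mul_lt_mul_of_pos_left (h1.trans_le h2) hρ'
      _ = (1 - ε) * ρ' := by ring
  -- box fit
  obtain ⟨M₀, hfit⟩ := exists_forall_box_fit hρ' hρ''0 hμ0 hδ.le hε0 hε1
    (by positivity : (0:ℝ) ≤ N₀ + 2) hκ
  -- the main claim: for large `M`, `E₀^D(M, L_M(ρ''))/M ≤ e₁`
  have hclaim : ∀ M : ℕ, max M₀ 1 ≤ M → energyPerParticleDirichlet v ρ'' M ≤ e₁ := by
    intro M hM
    have hMM₀ : M₀ ≤ M := (le_max_left _ _).trans hM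
    have hM1 : 1 ≤ M := (le_max_right _ _).trans hM
    have hM0 : (M : ℝ≥0∞) ≠ 0 := Nat.cast_ne_zero.2 (by omega)
    -- the particle number `N` of the state we compress
    set N : ℕ := ⌈((M : ℝ) + 1) / (1 - ε)⌉₊ + N₀ + 1 with hN
    have hNN₀ : N₀ ≤ N := by omega
    have hN1 : 0 < N := by omega
    have hNge : ((M : ℝ) + 1) / (1 - ε) ≤ N := by
      refine (Nat.le_ceil _).trans ?_
      rw [hN]; push_cast; linarith
    have hNle : (N : ℝ) ≤ ((M : ℝ) + 1) / (1 - ε) + (N₀ + 2) := by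
      have := Nat.ceil_lt_add_one (div_nonneg (by positivity) (by linarith) :
        (0:ℝ) ≤ ((M : ℝ) + 1) / (1 - ε))
      rw [hN]; push_cast; linarith
    set L : ℝ := sideLength ρ' N with hL
    -- a trial state with energy `< (G+1) N`
    have hgs : groundStateEnergy v N L < (G + 1) * N :=
      (hN₀ N hNN₀).trans_lt ((ENNReal.mul_lt_mul_iff_left (Nat.cast_ne_zero.2 hN1.ne')
        (ENNReal.natCast_ne_top N)).2 (ENNReal.lt_add_right hG one_ne_zero))
    rw [groundStateEnergy] at hgs
    obtain ⟨Ψ, hΨ⟩ := iInf_lt_iff.1 hgs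
    have hEtop : rawEnergy v Ψ.ψ ≠ ⊤ := (lt_of_lt_of_le hΨ le_top).ne
    have hKE : ∫⁻ X, kineticDensity Ψ.ψ X ≤ (G + 1) * N :=
      (lintegral_mono fun X => le_self_add).trans hΨ.le
    -- the Markov step
    obtain ⟨X₀, hX₀ne, hX₀count⟩ :=
      exists_ne_zero_tightCount_le ha hδ hδa hR hv hrange hcore Ψ.contDiff hEtop Ψ.norm_eq
    have hX₀box : X₀ ∈ boxN N L := by
      by_contra h; exact hX₀ne (Ψ.eq_zero X₀ h)
    have hX₀sep : ∀ i j : Fin N, i ≠ j → a < dist (X₀ i) (X₀ j) := fun i j hij =>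
      lt_dist_of_apply_ne_zero ha hv hcore Ψ.contDiff.continuous hEtop hX₀ne hij
    -- the tight set is small
    set T := tightParticles v a δ X₀ with hT
    have hTcard : ((T.card : ℕ) : ℝ) ≤ ε * N + 1 := by
      have h1 : ((T.card : ℕ) : ℝ≥0∞) ≤
          ENNReal.ofReal (200 * (2 * (R₀ + a) / a + 1) ^ 3 * δ ^ 2) * ((G + 1) * N) + 1 :=
        (card_tightParticles_le X₀).trans (hX₀count.trans
          (add_le_add (mul_le_mul' le_rfl hKE) le_rfl))
      have h2 : ENNReal.ofReal (200 * (2 * (R₀ + a) / a + 1) ^ 3 * δ ^ 2) * ((G + 1) * N) + 1 =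
          ENNReal.ofReal (ε * N + 1) := by
        rw [hG', ← ENNReal.ofReal_one, ← ENNReal.ofReal_add hg0 zero_le_one,
          ← ENNReal.ofReal_natCast N, ← ENNReal.ofReal_mul (by positivity),
          ← ENNReal.ofReal_mul (by positivity), ← ENNReal.ofReal_add (by positivity) zero_le_one]
        congr 1
        rw [hε, hP]; ring
      rw [h2] at h1
      have h3 := ENNReal.toReal_mono ENNReal.ofReal_ne_top h1
      rwa [ENNReal.toReal_ofReal (by positivity), ENNReal.toReal_natCast] at h3
    -- the good set has at least `M` particles
    set Gd : Finset (Fin N) := Tᶜ with hGd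
    have hGdcard : M ≤ Gd.card := by
      have hTle : T.card ≤ N := by simpa using T.card_le_univ
      have h1 : (Gd.card : ℝ) = N - T.card := by
        rw [hGd, Finset.card_compl, Fintype.card_fin, Nat.cast_sub hTle]
      have h2 : ((M : ℝ) + 1) ≤ (1 - ε) * N := by
        rwa [div_le_iff₀' (by linarith)] at hNge
      have h3 : (M : ℝ) ≤ Gd.card := by rw [h1]; nlinarith
      exact_mod_cast h3
    obtain ⟨S, hSG, hScard⟩ := Finset.exists_subset_card_eq hGdcard
    -- index the chosen good particles by `Fin M`, and by `ℕ`
    have hcardS : Fintype.card S = M := by simp [hScard]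
    let eS : Fin M ≃ S := (Fintype.equivFinOfCardEq hcardS).symm
    let idx : Fin M → Fin N := fun m => (eS m : Fin N)
    have hidx_mem : ∀ m, idx m ∈ S := fun m => (eS m).2
    have hidx_inj : Function.Injective idx := fun m m' h => eS.injective (Subtype.ext h)
    have hgood : ∀ m, idx m ∉ T := fun m => Finset.mem_compl.1 (hSG (hidx_mem m))
    have hM1' : 0 < M := hM1
    let idxN : ℕ → Fin N := fun m => if hm : m < M then idx ⟨m, hm⟩ else idx ⟨0, hM1'⟩
    have hidxN : ∀ (m : ℕ) (hm : m < M), idxN m = idx ⟨m, hm⟩ := fun m hm => by simp [idxN, hm]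
    have hidxN_ne : ∀ m m' : ℕ, m < M → m' < M → m ≠ m' → idxN m ≠ idxN m' := by
      intro m m' hm hm' hne h
      rw [hidxN m hm, hidxN m' hm'] at h
      exact hne (Fin.mk.inj_iff.1 (hidx_inj h))
    have hgoodN : ∀ (m : ℕ), m < M → idxN m ∉ T := fun m hm => by rw [hidxN m hm]; exact hgood _
    -- the scaled and shifted configuration, and the centres
    let cδ : Space := WithLp.toLp 2 fun _ => δ
    let Y : Config N := fun i => μ • X₀ i + cδ
    have hYdist : ∀ i j, dist (Y i) (Y j) = μ * dist (X₀ i) (X₀ j) := by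
      intro i j
      simp only [Y, dist_add_right, dist_smul₀, Real.norm_eq_abs, abs_of_pos hμ0]
    have hμhalf : 1 / 2 ≤ μ := by rw [hμ]; linarith
    have hYsep : ∀ i j : Fin N, i ≠ j → a / 2 ≤ dist (Y i) (Y j) := by
      intro i j hij
      rw [hYdist]
      have h1 := hX₀sep i j hij
      calc a / 2 = 1 / 2 * a := by ring
        _ ≤ μ * a := mul_le_mul_of_nonneg_right hμhalf ha.le
        _ ≤ μ * dist (X₀ i) (X₀ j) := mul_le_mul_of_nonneg_left h1.le hμ0.le
    let y : ℕ → Space := fun m => Y (idxN m)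
    have hsepU : ∀ m m', m < m' → m' < M → 2 * s ≤ dist (y m) (y m') := by
      intro m m' hmm' hm'
      have := hYsep _ _ (hidxN_ne m m' (hmm'.trans hm') hm' hmm'.ne)
      change 2 * s ≤ dist (Y (idxN m)) (Y (idxN m'))
      rw [hs]; linarith
    -- the cubes lie in the box of side `μ L + 2δ`
    have hUbox : clusterRegion y s M ⊆ box (μ * L + 2 * δ) := by
      intro z hz
      simp only [clusterRegion, Set.mem_iUnion, Finset.mem_range, exists_prop] at hz
      obtain ⟨m, hm, hzm⟩ := hz
      refine cubeAt_subset_box (fun k => ?_) hzm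
      have hk : X₀ (idxN m) k ∈ Set.Ioo 0 L := hX₀box (idxN m) k
      have hyk : y m k = μ * X₀ (idxN m) k + δ := by simp [y, Y, cδ]
      rw [hyk]
      have hs16 : s = δ / 16 := rfl
      constructor
      · have : 0 ≤ μ * X₀ (idxN m) k := mul_nonneg hμ0.le hk.1.le
        linarith
      · have : μ * X₀ (idxN m) k ≤ μ * L := mul_le_mul_of_nonneg_left hk.2.le hμ0.le
        linarith
    -- every scaled good pair keeps distance `≥ 3δ/4` from the hard radii
    have hrad : ∀ h ∈ hardRad v, h ≤ R₀ := fun h hh => le_of_mem_hardRad hrange hh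
    have hloose : ∀ (m m' : ℕ), m < M → m' < M → m ≠ m' →
        ∀ h ∈ hardRad v, 3 * δ / 4 ≤ |‖y m - y m'‖ - h| := by
      intro m m' hm hm' hne h hh
      have hij : idxN m' ≠ idxN m := (hidxN_ne m m' hm hm' hne).symm
      set d : ℝ := dist (X₀ (idxN m)) (X₀ (idxN m')) with hd
      have had : a < d := hX₀sep _ _ hij.symm
      have hnorm : ‖y m - y m'‖ = μ * d := by
        change ‖Y (idxN m) - Y (idxN m')‖ = μ * d
        rw [← dist_eq_norm, hYdist]
      rw [hnorm]
      have hhR := hrad h hh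
      by_cases hdR : d ≤ R₀ + a
      · -- near pair: not tight, and scaling moves the distance by at most `δ/4`
        have htight : δ ≤ |d - h| :=
          le_abs_sub_of_not_mem_tightParticles (hgoodN m hm) hij had hh
        have hmove : d - μ * d ≤ δ / 4 := by
          rw [hμ, hx, show d - (1 - δ / (4 * (R₀ + a))) * d = δ / (4 * (R₀ + a)) * d by ring]
          calc δ / (4 * (R₀ + a)) * d ≤ δ / (4 * (R₀ + a)) * (R₀ + a) :=
                mul_le_mul_of_nonneg_left hdR (by positivity)
            _ = δ / 4 := by field_simp
        have hmove0 : 0 ≤ d - μ * d := by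
          rw [hμ, show d - (1 - x) * d = x * d by ring]
          exact mul_nonneg hx0.le (ha.le.trans had.le)
        rw [abs_sub_comm] at htight
        -- `|h - μd| ≥ |h - d| - (d - μ d)`
        have := abs_sub_abs_le_abs_sub (h - d) (h - μ * d)
        rw [show h - d - (h - μ * d) = -(d - μ * d) by ring, abs_neg,
          abs_of_nonneg hmove0] at this
        rw [abs_sub_comm]
        linarith
      · -- far pair: still beyond every hard radius by `a - δ/4`
        push Not at hdR
        have h1 : μ * (R₀ + a) ≤ μ * d := mul_le_mul_of_nonneg_left hdR.le hμ0.le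
        have h2 : μ * (R₀ + a) = R₀ + a - δ / 4 := by rw [hμ, hx]; field_simp
        rw [abs_of_nonneg (by linarith)]
        linarith
    -- the pair terms
    have hpair_far : ∀ (m m' : ℕ), m < M → m' < M → m ≠ m' →
        R₀ + a ≤ dist (y m) (y m') → pairBall v y s m' m = 0 := by
      intro m m' hm hm' hne hfar
      unfold pairBall
      have h0 : ∀ w ∈ ball (y m - y m') (2 * s), v ‖w‖ = 0 := by
        intro w hw
        apply hrange
        rw [mem_ball, dist_eq_norm] at hw
        have h1 : ‖y m - y m'‖ - ‖w‖ ≤ ‖w - (y m - y m')‖ := by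
          rw [norm_sub_rev w (y m - y m')]; exact norm_sub_norm_le _ _
        rw [dist_eq_norm] at hfar
        have hs16 : s = δ / 16 := rfl
        linarith
      rw [setLIntegral_congr_fun measurableSet_ball h0]; simp
    have hpair_close : ∀ (m m' : ℕ), m < M → m' < M → m ≠ m' →
        dist (y m) (y m') < R₀ + a → pairBall v y s m' m ≤ I := by
      intro m m' hm hm' hne hclose
      unfold pairBall
      refine ballIntegral_le_setLIntegral_looseShell ?_ fun h hh => ?_
      · rw [← dist_eq_norm]
        have hs16 : s = δ / 16 := rfl
        linarith
      · have := hloose m m' hm hm' hne h hh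
        have hs16 : s = δ / 16 := rfl
        linarith
    -- the neighbour count of the scaled configuration
    have hcount : ∀ (m : ℕ), m < M →
        (((Finset.range m).filter fun m' => dist (y m) (y m') < R₀ + a).card : ℝ) ≤ P₂ := by
      intro m hm
      have hc := card_filter_dist_lt_le_pow (half_pos ha) hRa hYsep (idxN m)
      rw [hP₂]
      refine le_trans ?_ hc
      have hinj : ((Finset.range m).filter fun m' => dist (y m) (y m') < R₀ + a).card ≤
          (Finset.univ.filter fun j => j ≠ idxN m ∧ dist (Y (idxN m)) (Y j) < R₀ + a).card := by
        refine Finset.card_le_card_of_injOn idxN (fun m' hm' => ?_) (fun m₁ hm₁ m₂ hm₂ h => ?_)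
        · rw [Finset.mem_coe, Finset.mem_filter, Finset.mem_range] at hm'
          rw [Finset.mem_coe, Finset.mem_filter]
          exact ⟨Finset.mem_univ _, (hidxN_ne m m' hm (hm'.1.trans hm) hm'.1.ne').symm, hm'.2⟩
        · rw [Finset.mem_coe, Finset.mem_filter, Finset.mem_range] at hm₁ hm₂
          by_contra hne
          exact hidxN_ne m₁ m₂ (hm₁.1.trans hm) (hm₂.1.trans hm) hne h
      exact_mod_cast hinj
    have hsum_m : ∀ (m : ℕ), m < M →
        ∑ m' ∈ Finset.range m, pairBall v y s m' m ≤ ENNReal.ofReal P₂ * I := by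
      intro m hm
      rw [← Finset.sum_filter_add_sum_filter_not (Finset.range m)
        (fun m' => dist (y m) (y m') < R₀ + a)]
      have hz : ∑ m' ∈ (Finset.range m).filter (fun m' => ¬ dist (y m) (y m') < R₀ + a),
          pairBall v y s m' m = 0 := by
        refine Finset.sum_eq_zero fun m' hm' => ?_
        simp only [Finset.mem_filter, Finset.mem_range, not_lt] at hm'
        exact hpair_far m m' hm (hm'.1.trans hm) hm'.1.ne' hm'.2
      rw [hz, add_zero]
      calc ∑ m' ∈ (Finset.range m).filter (fun m' => dist (y m) (y m') < R₀ + a), pairBall v y s m' m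
          ≤ ∑ _m' ∈ (Finset.range m).filter (fun m' => dist (y m) (y m') < R₀ + a), I := by
            refine Finset.sum_le_sum fun m' hm' => ?_
            simp only [Finset.mem_filter, Finset.mem_range] at hm'
            exact hpair_close m m' hm (hm'.1.trans hm) hm'.1.ne' hm'.2
        _ = (((Finset.range m).filter fun m' => dist (y m) (y m') < R₀ + a).card : ℝ≥0∞) * I := by
            rw [Finset.sum_const, nsmul_eq_mul]
        _ ≤ ENNReal.ofReal P₂ * I := by
            refine mul_le_mul' ?_ le_rfl
            rw [← ENNReal.ofReal_natCast]
            exact ENNReal.ofReal_le_ofReal (hcount m hm)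
    -- energy of `M` particles in the box of side `μ L + 2δ`
    have hEM : groundStateEnergy v M (μ * L + 2 * δ) ≤ M * e₁ := by
      rw [groundStateEnergy_eq_infEnergy]
      calc infEnergy v M (box (μ * L + 2 * δ))
          ≤ infEnergy v M (clusterRegion y s M) := infEnergy_anti hUbox
        _ ≤ M * E₁ + C * ∑ m ∈ Finset.range M, ∑ m' ∈ Finset.range m, pairBall v y s m' m :=
            hcluster M y hsepU
        _ ≤ M * E₁ + C * ∑ _m ∈ Finset.range M, ENNReal.ofReal P₂ * I :=
            add_le_add le_rfl (mul_le_mul' le_rfl (Finset.sum_le_sum fun m hm =>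
              hsum_m m (Finset.mem_range.1 hm)))
        _ = M * e₁ := by
            rw [Finset.sum_const, Finset.card_range, nsmul_eq_mul, he₁, mul_add]
            ring
    -- the box fits, hence the bound at density `ρ''`
    have hfitM : μ * L + 2 * δ ≤ sideLength ρ'' M := hfit M hMM₀ N hNle
    calc energyPerParticleDirichlet v ρ'' M
        = groundStateEnergy v M (sideLength ρ'' M) / M := rfl
      _ ≤ groundStateEnergy v M (μ * L + 2 * δ) / M :=
          ENNReal.div_le_div_right (groundStateEnergy_anti v M hfitM) _
      _ ≤ M * e₁ / M := ENNReal.div_le_div_right hEM _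
      _ = e₁ := by rw [mul_comm]; exact ENNReal.mul_div_cancel_right hM0 (ENNReal.natCast_ne_top M)
  -- conclusion
  refine lt_of_le_of_lt ?_ he₁top
  exact Filter.limsup_le_of_le (h := (eventually_atTop.2 ⟨max M₀ 1, hclaim⟩))

end Compression

/-! ### Blow-up at the critical density and the vendored facts -/

section BlowUp

variable {a R₀ : ℝ} {v : ℝ → ℝ≥0∞}

/-- **Blow-up at the critical density, hard-core form.** For a measurable potential of range `R₀`
with a hard core `B(0,a) ⊆ 𝓗(v)` and any `ρ ≥ ρ_c(v)`, the left envelope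
`sup_{0<ρ'<ρ} e⁺(ρ')` is `+∞`; otherwise the compression lemma would give a finite upper energy
per particle strictly above `ρ_c(v)`. [folklore] -/
theorem iSup_limsupEnergyPerParticle_eq_top_of_hardSet (ha : 0 < a) (hR : 0 ≤ R₀)
    (hv : Measurable v) (hrange : ∀ r, R₀ < r → v r = 0)
    (hcore : ball (0 : Space) a ⊆ hardVec v) {ρ : ℝ}
    (hρc : criticalDensity v ≤ ENNReal.ofReal ρ) :
    (⨆ (ρ' : ℝ) (_ : 0 < ρ' ∧ ρ' < ρ), limsupEnergyPerParticle v ρ') = ⊤ := by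
  by_contra hne
  set Gm := ⨆ (ρ' : ℝ) (_ : 0 < ρ' ∧ ρ' < ρ), limsupEnergyPerParticle v ρ' with hGm
  have hvR : IsRepulsiveFiniteRange v := ⟨hv, R₀, hrange⟩
  have hρpos : 0 < ρ := by
    have h := (criticalDensity_pos hvR).trans_le hρc
    simpa using h
  have hRa : 0 < R₀ + a := by linarith
  set G : ℝ≥0∞ := Gm + 1 with hGdef
  have hG : G ≠ ⊤ := by simpa [hGdef] using hne
  set g : ℝ := G.toReal with hg
  have hg0 : 0 ≤ g := ENNReal.toReal_nonneg
  set K : ℝ := 12800 * (2 * (R₀ + a) / a + 1) ^ 3 * (R₀ + a) * (g + 1) with hK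
  have hK0 : 0 < K := by positivity
  set δ : ℝ := min (a / 20) (1 / K) with hδ
  have hδ0 : 0 < δ := lt_min (by positivity) (by positivity)
  have hδa : 20 * δ ≤ a := by
    have := min_le_left (a / 20) (1 / K); linarith
  have hδG : 12800 * (2 * (R₀ + a) / a + 1) ^ 3 * (R₀ + a) * (g + 1) * δ ≤ 1 := by
    have h := min_le_right (a / 20) (1 / K)
    rw [le_div_iff₀ hK0] at h
    rw [← hK]; linarith
  set κ : ℝ := δ / (8 * (R₀ + a)) with hκ
  have hκ0 : 0 < κ := by positivity
  set ρ' : ℝ := ρ / (1 + κ / 2) with hρ'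
  have hρ'0 : 0 < ρ' := by positivity
  have hρ'lt : ρ' < ρ := div_lt_self hρpos (by linarith)
  -- `e⁺(ρ') ≤ Gm < G`, hence `E₀^D(N, L_N(ρ')) ≤ G N` eventually
  have hlim : limsupEnergyPerParticle v ρ' < G :=
    (le_iSup₂ (f := fun ρ' (_ : 0 < ρ' ∧ ρ' < ρ) => limsupEnergyPerParticle v ρ') ρ'
      ⟨hρ'0, hρ'lt⟩).trans_lt (ENNReal.lt_add_right hne one_ne_zero)
  have hbound : ∀ᶠ N : ℕ in atTop, groundStateEnergy v N (sideLength ρ' N) ≤ G * N := by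
    have hev : ∀ᶠ N : ℕ in atTop, energyPerParticleDirichlet v ρ' N < G :=
      Filter.eventually_lt_of_limsup_lt hlim
    filter_upwards [hev, eventually_gt_atTop 0] with N hN hN0
    rw [energyPerParticleDirichlet, ENNReal.div_lt_iff (Or.inl (Nat.cast_ne_zero.2 hN0.ne'))
      (Or.inl (ENNReal.natCast_ne_top N))] at hN
    exact hN.le
  have hfin := limsupEnergyPerParticle_lt_top_of_compression_hardSet ha hR hv hrange hcore hδ0
    hδa hρ'0 hG hδG hbound
  -- but `ρ'(1 + κ) > ρ ≥ ρ_c(v)`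
  have hgt : ρ < ρ' * (1 + δ / (8 * (R₀ + a))) := by
    rw [← hκ, hρ', div_mul_eq_mul_div, lt_div_iff₀ (by positivity)]
    nlinarith
  have hle : ENNReal.ofReal (ρ' * (1 + δ / (8 * (R₀ + a)))) ≤ criticalDensity v :=
    le_iSup₂ (f := fun ρ (_ : 0 < ρ ∧ limsupEnergyPerParticle v ρ < ⊤) => ENNReal.ofReal ρ) _
      ⟨by positivity, hfin⟩
  have h := hle.trans hρc
  rw [ENNReal.ofReal_le_ofReal_iff hρpos.le] at h
  linarith

/-- **Blow-up of the energy per particle at the critical density, for every repulsive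
finite-range pair potential.** If `ρ_c(v) ≤ ρ` then `sup_{0<ρ'<ρ} e⁺(ρ') = +∞`: a finite critical
density forces a hard core (`exists_ball_subset_hardVec_of_criticalDensity_lt_top`), for which the
hard-core form applies. [cite: Ruelle1969, §3.3.12 and §3.5.11] -/
theorem iSup_limsupEnergyPerParticle_eq_top_of_criticalDensity_le (hv : IsRepulsiveFiniteRange v)
    {ρ : ℝ} (hρc : criticalDensity v ≤ ENNReal.ofReal ρ) :
    (⨆ (ρ' : ℝ) (_ : 0 < ρ' ∧ ρ' < ρ), limsupEnergyPerParticle v ρ') = ⊤ := by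
  obtain ⟨R₀, hR₀, hrange⟩ := hv.exists_pos_range
  obtain ⟨a, ha, hcore⟩ := exists_ball_subset_hardVec_of_criticalDensity_lt_top hv
    (hρc.trans_lt ENNReal.ofReal_lt_top)
  exact iSup_limsupEnergyPerParticle_eq_top_of_hardSet ha hR₀.le hv.1 hrange hcore hρc

/-- **At and above the critical density the Dirichlet energies per particle tend to `+∞`**, for
every repulsive finite-range pair potential. [cite: Ruelle1969, §3.5.11 (b), (c)] -/
theorem tendsto_energyPerParticleDirichlet_top_of_criticalDensity_le (hv : IsRepulsiveFiniteRange v)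
    {ρ : ℝ} (hρc : criticalDensity v ≤ ENNReal.ofReal ρ) :
    Tendsto (energyPerParticleDirichlet v ρ) atTop (𝓝 ⊤) :=
  tendsto_energyPerParticleDirichlet_top_of_iSup_limsup_eq_top hv
    (iSup_limsupEnergyPerParticle_eq_top_of_criticalDensity_le hv hρc)

/-- **Existence of the thermodynamic limit of the Dirichlet energy per particle at every density,
for every repulsive finite-range pair potential**: the limit is `e⁺(ρ) < ∞` for `ρ < ρ_c(v)`
(Ruelle) and `+∞` for `ρ ≥ ρ_c(v)`. [cite: LSSY2005, Ch. 2 eq. (2.2); Ruelle1969 §3.5.11] -/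
theorem exists_tendsto_energyPerParticleDirichlet (hv : IsRepulsiveFiniteRange v) {ρ : ℝ}
    (hρ : 0 < ρ) : ∃ e : ℝ≥0∞, Tendsto (energyPerParticleDirichlet v ρ) atTop (𝓝 e) := by
  by_cases hlt : ENNReal.ofReal ρ < criticalDensity v
  · exact ⟨_, tendsto_energyPerParticleDirichlet_of_lt_criticalDensity hv hρ hlt⟩
  · exact ⟨⊤, tendsto_energyPerParticleDirichlet_top_of_criticalDensity_le hv (not_lt.1 hlt)⟩

/-- **Discharge of the vendored fact `LSSY2005_e0_dirichlet_exists`** (LSSY 2005, (2.2): "The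
energy per particle in this limit is `e₀(ρ) = lim_{L → ∞} E₀(ρL³, L)/(ρL³)`"): for every
repulsive finite-range pair potential (the scattering-length hypothesis is automatic) and every
`ρ > 0` the Dirichlet energies per particle `E₀^D(N, (N/ρ)^{1/3})/N` converge in `[0, ∞]`.
[cite: LSSY2005, Ch. 2 eq. (2.2)] -/
theorem LSSY2005_e0_dirichlet_exists_holds : LSSY2005_e0_dirichlet_exists :=
  fun _ hv _ _ hρ => exists_tendsto_energyPerParticleDirichlet hv hρ

/-- **Discharge of the vendored fact `LSSY2005_e0_periodic_eq_dirichlet`** (LSSY 2005, Ch. 2: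
"These [boundary conditions] should not matter for the thermodynamic limit"): by
`LSSY2005_e0_periodic_eq_dirichlet_iff_atCritical_of_iSup_lt_top` the fact reduces to densities
`ρ = ρ_c(v)` with a finite left envelope, which the blow-up theorem excludes.
[cite: LSSY2005, Ch. 2, paragraph after (2.2); Thm. 2.2 ("for all boundary conditions")] -/
theorem LSSY2005_e0_periodic_eq_dirichlet_holds : LSSY2005_e0_periodic_eq_dirichlet :=
  LSSY2005_e0_periodic_eq_dirichlet_iff_atCritical_of_iSup_lt_top.2 fun _ hv _ _ hc hlt _ _ =>
    absurd (iSup_limsupEnergyPerParticle_eq_top_of_criticalDensity_le hv hc.ge) hlt.ne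

end BlowUp

end Literature.MathematicalPhysics.QuantumManyBody.BoseGas

end
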